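import Summits.HodgeConjecture.HodgeConjecture.Theorems.F0P3bArchDegOnePackageDefs
import Literature.RepresentationTheory.BorelWallach2000.UpqConjugateModuleAxioms
import HarnessLib

/-!
# FLOOR-0 P3b «ENGINE local packets T3 ∕ T4», line `F0_LocalAPackets` — STUB T3a₆ CLOSED:
# conjugation preserves `IsCohUnitaryIrrep` (generic `U(α, β)`)

Cell hodgecm-mathlib (D-0151), FLOOR 0, crux item H413 = stmt-HodgeConjecture-24833; sub-line
`Cruxes/H413/Lines/F0_LocalAPackets.lean` (F0P3b-plan (g4), edition 1, commit 2a4b8a813d3e), registered stub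
`stub_T3aConjCohUnitary : StubT3aConjCohUnitary` (§2 there; card brief B4).  PROOF lane (theorems only; no `def`, no `sorry`);
author A-p18 (g17).  Per the cell's stub-closer protocol (director s347) the Lines module is NOT imported: the theorem's TYPE is the
body of `…Cruxes.H413.F0LocalAPackets.StubT3aConjCohUnitary` BINDER FOR BINDER (all its constants — `IsCohUnitaryIrrep`,
`UpqConj.kAct`, `UpqConj.lieAct` — are ★ tree declarations), so that the by-name fold
`theorem stub_T3aConjCohUnitary : StubT3aConjCohUnitary := F0P3bStubT3aConjCohUnitary.stubT3aConjCohUnitary_holds`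
elaborates by unfolding one `def` at the line's next edition.

Content ([BorelWallach2000, II §4.2 (3), 0 §2.5]; [Bump1997, proof of Thm. 2.6.5]).  The conjugate module
`V^c = (ρK ∘ σ, ρ𝔤 ∘ σ)` (`σ` = entrywise complex conjugation of `U(α, β)`, ★ `UpqConj.kAct` ∕ `UpqConj.lieAct`) of an
irreducible unitary cohomologically relevant `(𝔤, K)`-module is again one: `gk`, `irred`, `adm` are the ★ transports
`UpqConj.isGKModule`, `UpqConj.isIrreducibleGK_iff`, `UpqConj.isAdmissibleGK` (`UpqConjugateModule(Axioms)`); for `unit`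
(`IsUnitaryAlongP`, ★ `Theorems/F0P3bArchDegOnePackageDefs`: a real symmetric positive-definite `B` on `V`, skew for the
`𝔭`-frame `upqPBasis s` and for `z₀ = upqZ0 α β`, with `B(i a, b) = −B(a, i b)`) the SAME form `B` serves `V^c`, because
`σ` PERMUTES the `𝔭`-frame — `σ(x_{(p,0)}) = x_{(p,1)}`, `σ(x_{(p,1)}) = x_{(p,0)}` (★ `upqConjLie_upqUnit` and
`conj((1 ± i)/2) = (1 ∓ i)/2`; `upqConjLie_upqPBasis_zero ∕ _one` below) — and NEGATES `z₀` (★ `upqConjLie_upqZ0`), and skewness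
is insensitive to the sign (`isUnitaryAlongP_lieAct`).

HC_CM is proved only modulo the 7 printed citations until rung 0 closes; this closes ONE generic stub (T3a₆) of ONE floor-0 sub-line.

## References
* [BorelWallach2000] A. Borel, N. Wallach, *Continuous Cohomology, Discrete Subgroups, and Representations of Reductive Groups*,
  2nd ed., AMS 2000 — 0 §2.5, II §1.1 (5) (the frame `x_s` of `𝔭`), II §4.1–4.2 (`σ z₀ = −z₀`, `𝔭^±` conjugate).
* [Bump1997] D. Bump, *Automorphic Forms and Representations*, CUP 1997 — proof of Thm. 2.6.5 (the involution `ι`).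
-/

-- Mathlib idiom (as in `GKModules`, the `Upq*` files and the line): commutator bracket on `Module.End`
attribute [local instance 100] LieRing.ofAssociativeRing

set_option autoImplicit false
set_option linter.dupNamespace false

noncomputable section

namespace Summit.HodgeConjecture.HodgeConjecture.Cruxes.H413.F0P3bStubT3aConjCohUnitary

open Literature.NumberTheory.Automorphic
open Literature.RepresentationTheory.BorelWallach2000
open Literature.RepresentationTheory.KonnoKonno2007 Literature.RepresentationTheory.KonnoKonno2007.RealDualPair
open Literature.RepresentationTheory.KonnoKonno2007.RealDualPair.UForm
open Summit.HodgeConjecture.HodgeConjecture.Cruxes.H413.F0P3bArchDegOnePackage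

variable {α β : Type*} [Fintype α] [DecidableEq α] [Fintype β] [DecidableEq β]

/-! ## §1 `σ` permutes the `𝔭`-frame `x_{(p,0)} ↔ x_{(p,1)}` -/

/-- `conj e₀ = e₁` for the frame coefficients `e₀ = (1+i)/2`, `e₁ = (1−i)/2`. [cite: BorelWallach2000, II §1.1 (5)] -/
theorem conj_upqPCoeff_zero : starRingEnd ℂ (upqPCoeff 0) = upqPCoeff 1 := by
  simp only [upqPCoeff, Fin.isValue, ↓reduceIte, one_ne_zero, map_div₀, map_add, map_one, Complex.conj_I, map_ofNat]
  ring

/-- `conj e₁ = e₀`. [cite: BorelWallach2000, II §1.1 (5)] -/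
theorem conj_upqPCoeff_one : starRingEnd ℂ (upqPCoeff 1) = upqPCoeff 0 := by
  simp only [upqPCoeff, Fin.isValue, ↓reduceIte, one_ne_zero, map_div₀, map_sub, map_one, Complex.conj_I, map_ofNat]
  ring

/-- **`σ(x_{(p,0)}) = x_{(p,1)}`**: conjugation maps the first frame vector over the matrix unit `E_p` of `𝔭` to the second
(`σ(X_c) = X_{c̄}`, ★ `upqConjLie_upqUnit`). [cite: BorelWallach2000, II §4.2] -/
theorem upqConjLie_upqPBasis_zero (p : α × β) : upqConjLie (upqPBasis (p, 0)) = upqPBasis (p, 1) := by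
  show upqConjLie (upqUnit p (upqPCoeff 0)) = upqUnit p (upqPCoeff 1)
  rw [upqConjLie_upqUnit, conj_upqPCoeff_zero]

/-- **`σ(x_{(p,1)}) = x_{(p,0)}`**. [cite: BorelWallach2000, II §4.2] -/
theorem upqConjLie_upqPBasis_one (p : α × β) : upqConjLie (upqPBasis (p, 1)) = upqPBasis (p, 0) := by
  show upqConjLie (upqUnit p (upqPCoeff 1)) = upqUnit p (upqPCoeff 0)
  rw [upqConjLie_upqUnit, conj_upqPCoeff_one]

/-- **`σ` permutes the `𝔭`-frame**: `σ(x_{(p,k)}) = x_{(p,k′)}` for some `k′`. [cite: BorelWallach2000, II §4.2] -/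
theorem exists_upqConjLie_upqPBasis (s : (α × β) × Fin 2) : ∃ s' : (α × β) × Fin 2, upqConjLie (upqPBasis s) = upqPBasis s' := by
  obtain ⟨p, k⟩ := s
  fin_cases k
  · exact ⟨(p, 1), upqConjLie_upqPBasis_zero p⟩
  · exact ⟨(p, 0), upqConjLie_upqPBasis_one p⟩

/-! ## §2 Unitarity along `𝔭 ⊕ ℝz₀` passes to the conjugate module -/

section Module

variable {V : Type*} [AddCommGroup V] [Module ℂ V]
  (ρK : Representation ℂ (uFormGroup α β).maximalCompact V)
  (ρ𝔤 : (uFormGroup α β).lie →ₗ⁅ℝ⁆ Module.End ℂ V)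

/-- **`IsUnitaryAlongP ρ𝔤 → IsUnitaryAlongP (ρ𝔤 ∘ σ)`**: the same real form `B` is symmetric, positive definite, satisfies
`B(i a, b) = −B(a, i b)`, and is skew for `ρ𝔤(σ x_s) = ρ𝔤(x_{s′})` (frame permuted) and for `ρ𝔤(σ z₀) = −ρ𝔤(z₀)`.
[cite: BorelWallach2000, 0 §2.5, II §4.2] -/
theorem isUnitaryAlongP_lieAct (h : IsUnitaryAlongP ρ𝔤) : IsUnitaryAlongP (UpqConj.lieAct ρ𝔤) := by
  obtain ⟨B, hsym, hnn, hdef, hP, hZ, hI⟩ := h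
  -- read the form and its properties on `V` itself (the two carriers are `V` definitionally)
  let B₀ : V →ₗ[ℝ] V →ₗ[ℝ] ℝ := B
  have hsym₀ : ∀ a b : V, B₀ a b = B₀ b a := hsym
  have hnn₀ : ∀ a : V, 0 ≤ B₀ a a := hnn
  have hdef₀ : ∀ a : V, B₀ a a = 0 → a = 0 := hdef
  have hP₀ : ∀ (s : (α × β) × Fin 2) (a b : V), B₀ (ρ𝔤 (upqPBasis s) a) b = -B₀ a (ρ𝔤 (upqPBasis s) b) := hP
  have hZ₀ : ∀ a b : V, B₀ (ρ𝔤 (upqZ0 α β) a) b = -B₀ a (ρ𝔤 (upqZ0 α β) b) := hZ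
  have hI₀ : ∀ a b : V, B₀ (Complex.I • a) b = -B₀ a (Complex.I • b) := hI
  have hP₁ : ∀ (s : (α × β) × Fin 2) (a b : V),
      B₀ (ρ𝔤 (upqConjLie (upqPBasis s)) a) b = -B₀ a (ρ𝔤 (upqConjLie (upqPBasis s)) b) := by
    intro s a b
    obtain ⟨s', hs'⟩ := exists_upqConjLie_upqPBasis s
    rw [hs']
    exact hP₀ s' a b
  have hZ₁ : ∀ a b : V, B₀ (ρ𝔤 (upqConjLie (upqZ0 α β)) a) b = -B₀ a (ρ𝔤 (upqConjLie (upqZ0 α β)) b) := by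
    intro a b
    simp only [upqConjLie_upqZ0, map_neg, LinearMap.neg_apply, hZ₀, neg_neg]
  exact ⟨B₀, hsym₀, hnn₀, hdef₀, hP₁, hZ₁, hI₀⟩

/-- **Conjugation preserves `IsCohUnitaryIrrep`** (the four fields transported: ★ `UpqConj.isGKModule`,
★ `UpqConj.isIrreducibleGK_iff`, ★ `UpqConj.isAdmissibleGK`, and `isUnitaryAlongP_lieAct`). [cite: BorelWallach2000, II §4.2 (3)] -/
theorem isCohUnitaryIrrep_conj (h : IsCohUnitaryIrrep ρK ρ𝔤) : IsCohUnitaryIrrep (UpqConj.kAct ρK) (UpqConj.lieAct ρ𝔤) where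
  gk := UpqConj.isGKModule ρK ρ𝔤 h.gk
  irred := (UpqConj.isIrreducibleGK_iff ρK ρ𝔤).2 h.irred
  adm := UpqConj.isAdmissibleGK ρK h.adm
  unit := isUnitaryAlongP_lieAct ρ𝔤 h.unit

end Module

/-! ## §3 The stub T3a₆ (type = the registered def body) -/

/-- **T3a₆ · CONJUGATION PRESERVES `IsCohUnitaryIrrep`** (generic `U(α, β)`; the REGISTERED statement `StubT3aConjCohUnitary` of
`Lines/F0_LocalAPackets.lean` binder for binder).  `gk`, `irred`, `adm` by the ★ iff's ∕ transports of `UpqConjugateModule(Axioms)`;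
`unit`: the same real form `B` serves `ρ𝔤 ∘ σ` because `σ` maps the `𝔭`-frame vectors `x_s` to frame vectors and `z₀` to `−z₀`.
[cite: BorelWallach2000, II §4.2 (3)] -/
theorem stubT3aConjCohUnitary_holds :
    ∀ (α β : Type) [Fintype α] [DecidableEq α] [Fintype β] [DecidableEq β]
      (V : Type) [AddCommGroup V] [Module ℂ V]
      (ρK : Representation ℂ (uFormGroup α β).maximalCompact V) (ρ𝔤 : (uFormGroup α β).lie →ₗ⁅ℝ⁆ Module.End ℂ V),
      IsCohUnitaryIrrep ρK ρ𝔤 → IsCohUnitaryIrrep (UpqConj.kAct ρK) (UpqConj.lieAct ρ𝔤) :=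
  fun _ _ _ _ _ _ _ _ _ ρK ρ𝔤 h => isCohUnitaryIrrep_conj ρK ρ𝔤 h

end Summit.HodgeConjecture.HodgeConjecture.Cruxes.H413.F0P3bStubT3aConjCohUnitary

end
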